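import Mathlib
import Literature.Analysis.Complex.LoewnerLemma

/-!
# `ParafermionToSLESixFamilies` (stmt-CriticalPhenomena-11389), negative side: the foliation
# identification lemma is false WITHOUT the bound `0 ≤ ℓ ≤ 1`

Crux-triage (round 1) support file for the crux `CardyComplexCone.ParafermionToSLESixFamilies`.
The idea card `left-passage-foliation-lock` (crux dir `Cruxes/ParafermionToSLESixFamilies/Ideas/`)
files as its first lemma `FoliationIdentification` (workfile `FirstLemmasIdeator3.lean`): on the unit
disc with the arc `(α, β)`, a harmonic `H` that is SOME function `G` of a continuous field `ℓ` tending
to `1` on the open arc and to `0` on the complementary open arc is affine in the harmonic measure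
`arcHM α β` — "with NO hypothesis on `H` or `ℓ` at the two endpoints and no a-priori bound on `H`".
The typed signature also puts no bound on `ℓ` (in the application `ℓ` is a probability).

As typed the statement is false: the Poisson kernel `P` of the disc at an arc ENDPOINT is harmonic,
tends to `0` at every point of both OPEN arcs, and is unbounded; so `H = ℓ := arcHM 0 π + P`,
`G := id` satisfies every hypothesis while `H - c₁·arcHM 0 π - c₀` is unbounded for all `c₀, c₁`
(`0 ≤ arcHM ≤ 1`).  `not_FoliationIdentification` below negates the VERBATIM body of the workfile
declaration (definitionally the original; checked against the workfile module in the triager's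
folder, `FoliationCounterexample2.lean`, rc 0).

Reading for the line: the counterexample has `ℓ` UNBOUNDED (`ℓ > 1` in a lobe at the endpoint).  The
repair is the hypothesis `∀ z ∈ ball 0 1, ℓ z ∈ Icc 0 1` (free for a left-passage probability): with it
`sup |H| ≤ sup_{[0,1]} |G|`, and the card's own sketch (cross-cut bound on `G|[ε,1-ε]`, Lindelöf's
maximum principle with the two endpoints exceptional on the bands `{s_k < ℓ < s_{k+1}}`, local Fatou
against `G → ±∞`, then Fatou/Poisson) appears to go through — not checked here.  So this is a
signature defect of the first lemma, not a refutation of the card's lever.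
-/

noncomputable section

open Set Filter Metric Topology Complex InnerProductSpace
open scoped Real

namespace Summit.CriticalPhenomena.CardyFormulaZ2.Theorems.ParafermionToSLESixFamilies.Negative

open Literature.Analysis.Complex

/-- The Poisson kernel of the unit disc at the boundary point `1`: `Re((1+z)/(1-z)) = (1-|z|²)/|1-z|²`. -/
def P (z : ℂ) : ℝ := ((1 + z) / (1 - z)).re

/-- `1 - z ≠ 0` inside the unit disc. -/
theorem one_sub_ne_zero_of_norm_lt {z : ℂ} (hz : ‖z‖ < 1) : (1 : ℂ) - z ≠ 0 := by
  intro h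
  have hz1 : z = 1 := (sub_eq_zero.1 h).symm
  rw [hz1, norm_one] at hz
  exact lt_irrefl _ hz

/-- `w ↦ (1 + w)/(1 - w)` is analytic away from `w = 1`. -/
theorem analyticAt_frac {z : ℂ} (hz : (1 : ℂ) - z ≠ 0) :
    AnalyticAt ℂ (fun w : ℂ => (1 + w) / (1 - w)) z :=
  (analyticAt_const.add analyticAt_id).div (analyticAt_const.sub analyticAt_id) hz

/-- The Poisson kernel `P` is harmonic on the unit disc (real part of a holomorphic function). -/
theorem harmonicOnNhd_P : HarmonicOnNhd P (ball (0 : ℂ) 1) := fun _ hz =>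
  (analyticAt_frac (one_sub_ne_zero_of_norm_lt (mem_ball_zero_iff.1 hz))).harmonicAt_re

/-- `P` vanishes at every point `e^{it}` of the unit circle (at `t ∈ 2πℤ` by junk arithmetic `2/0 = 0`). -/
theorem P_exp_mul_I (t : ℝ) : P (exp (t * I)) = 0 := by
  have hn : ((1 : ℂ) + exp (t * I)).re * ((1 : ℂ) - exp (t * I)).re
      + ((1 : ℂ) + exp (t * I)).im * ((1 : ℂ) - exp (t * I)).im = 0 := by
    simp only [add_re, one_re, sub_re, add_im, one_im, sub_im, exp_ofReal_mul_I_re,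
      exp_ofReal_mul_I_im]
    linear_combination (-1 : ℝ) * Real.sin_sq_add_cos_sq t
  unfold P
  rw [div_re, ← add_div, hn, zero_div]

/-- `P → 0` inside the disc at every boundary point other than the endpoint `1`. -/
theorem tendsto_P_zero {t : ℝ} (h0 : 0 < t) (h2 : t < 2 * π) :
    Tendsto P (𝓝[ball (0 : ℂ) 1] (exp (t * I))) (𝓝 0) := by
  have hne : exp (t * I) ≠ 1 := by
    have := exp_mul_I_ne_of_lt h0 (by linarith : t - 0 < 2 * π)
    simpa using this
  have h1 : (1 : ℂ) - exp (t * I) ≠ 0 := sub_ne_zero.2 (Ne.symm hne)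
  have hc : ContinuousAt P (exp (t * I)) :=
    Complex.continuous_re.continuousAt.comp (analyticAt_frac h1).continuousAt
  have h := hc.tendsto
  rw [P_exp_mul_I] at h
  exact h.mono_left nhdsWithin_le_nhds

/-- On the real diameter `P r = (1 + r)/(1 - r)`, unbounded as `r → 1⁻`. -/
theorem P_ofReal (r : ℝ) : P (r : ℂ) = (1 + r) / (1 - r) := by
  unfold P
  have h : ((1 : ℂ) + r) / (1 - r) = (((1 + r) / (1 - r) : ℝ) : ℂ) := by norm_cast
  rw [h, ofReal_re]

/-- **The first lemma `FoliationIdentification` of card `left-passage-foliation-lock` is false as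
stated.**  The negated statement is the VERBATIM body of
`Summit.CriticalPhenomena.CardyFormulaZ2.Cruxes.ParafermionToSLESixFamilies.Sketch.FoliationIdentification`
(workfile `FirstLemmasIdeator3.lean`); counterexample `H = ℓ = arcHM 0 π + P`, `G = id`. -/
theorem not_FoliationIdentification :
    ¬ (∀ (α β : ℝ), α < β → β - α < 2 * π →
        ∀ (H ℓ : ℂ → ℝ) (G : ℝ → ℝ),
          InnerProductSpace.HarmonicOnNhd H (ball (0 : ℂ) 1) →
          ContinuousOn ℓ (ball (0 : ℂ) 1) →
          (∀ t ∈ Ioo α β, Tendsto ℓ (𝓝[ball (0 : ℂ) 1] (exp (t * I))) (𝓝 1)) →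
          (∀ t ∈ Ioo β (α + 2 * π), Tendsto ℓ (𝓝[ball (0 : ℂ) 1] (exp (t * I))) (𝓝 0)) →
          (∀ z ∈ ball (0 : ℂ) 1, H z = G (ℓ z)) →
          ∃ c₀ c₁ : ℝ, ∀ z ∈ ball (0 : ℂ) 1,
            H z = c₀ + c₁ * Literature.Analysis.Complex.arcHM α β z) := by
  intro h
  have hπ : (0 : ℝ) < π := Real.pi_pos
  have h2π : π - 0 < 2 * π := by linarith
  have hA : HarmonicOnNhd (arcHM 0 π) (ball (0 : ℂ) 1) := harmonicOnNhd_arcHM hπ h2π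
  have hH : HarmonicOnNhd (arcHM 0 π + P) (ball (0 : ℂ) 1) := hA.add harmonicOnNhd_P
  have hcont : ContinuousOn (arcHM 0 π + P) (ball (0 : ℂ) 1) := hH.continuousOn
  have hone : ∀ t ∈ Ioo (0 : ℝ) π,
      Tendsto (arcHM 0 π + P) (𝓝[ball (0 : ℂ) 1] (exp (t * I))) (𝓝 1) := by
    intro t ht
    have h1 := tendsto_arcHM_one (α := 0) (β := π) h2π ht
    have h2 := tendsto_P_zero (t := t) ht.1 (by linarith [ht.2])
    simpa [Pi.add_def] using h1.add h2
  have hzero : ∀ t ∈ Ioo π ((0 : ℝ) + 2 * π),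
      Tendsto (arcHM 0 π + P) (𝓝[ball (0 : ℂ) 1] (exp (t * I))) (𝓝 0) := by
    intro t ht
    have h1 := tendsto_arcHM_zero (α := 0) (β := π) hπ ht
    have h2 := tendsto_P_zero (t := t) (by linarith [ht.1]) (by linarith [ht.2])
    simpa [Pi.add_def] using h1.add h2
  obtain ⟨c₀, c₁, hc⟩ := h 0 π hπ h2π (arcHM 0 π + P) (arcHM 0 π + P) id
    hH hcont hone hzero (fun z _ => rfl)
  -- evaluate at the real point r = M/(M+1), where P r = 2M+1 exceeds the bound M-1 on the right side
  set M : ℝ := |c₀| + |c₁ - 1| + 1 with hM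
  have hM1 : 1 ≤ M := by
    have := abs_nonneg c₀; have := abs_nonneg (c₁ - 1); linarith
  have hM0 : 0 < M + 1 := by linarith
  set r : ℝ := M / (M + 1) with hr
  have hr0 : 0 ≤ r := div_nonneg (by linarith) hM0.le
  have hr1 : r < 1 := (div_lt_one hM0).2 (by linarith)
  have hrball : ((r : ℝ) : ℂ) ∈ ball (0 : ℂ) 1 := by
    rw [mem_ball_zero_iff, Complex.norm_real, Real.norm_eq_abs, abs_of_nonneg hr0]; exact hr1
  have hcr := hc r hrball
  simp only [Pi.add_apply] at hcr
  rw [P_ofReal] at hcr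
  have h1r : 1 - r = 1 / (M + 1) := by rw [hr]; field_simp; ring
  have h1r' : 1 + r = (2 * M + 1) / (M + 1) := by rw [hr]; field_simp; ring
  have hPr : (1 + r) / (1 - r) = 2 * M + 1 := by
    rw [h1r, h1r']; field_simp
  have hA0 : 0 ≤ arcHM 0 π r := arcHM_nonneg hπ h2π hrball
  have hA1 : arcHM 0 π r ≤ 1 := arcHM_le_one 0 π r
  have key : (c₁ - 1) * arcHM 0 π r ≤ |c₁ - 1| := by
    calc (c₁ - 1) * arcHM 0 π r ≤ |c₁ - 1| * arcHM 0 π r :=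
          mul_le_mul_of_nonneg_right (le_abs_self _) hA0
      _ ≤ |c₁ - 1| * 1 := mul_le_mul_of_nonneg_left hA1 (abs_nonneg _)
      _ = |c₁ - 1| := mul_one _
  rw [sub_mul, one_mul] at key
  have hc0 : c₀ ≤ |c₀| := le_abs_self _
  rw [hPr] at hcr
  linarith [hcr, key, hc0, hM1]

end Summit.CriticalPhenomena.CardyFormulaZ2.Theorems.ParafermionToSLESixFamilies.Negative
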